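import Summits.CriticalPhenomena.SAWScalingLimit.Theses.SAWTrackTransport
import Literature.Probability.RandomPlanarGeometry.IsometryCovariance
import HarnessLib

/-!
# Line `tip_kernel` for the crux `AxiomsOfLimit` of route `SAWTrackTransport` (stmt-CriticalPhenomena-16965)

Strategist unit `cstrat-stmt-CriticalPhenomena-16965-b1` (planner-cstrat-stmt-CriticalPhenomena-16965-b1-0),
2026-08-17. An ALTERNATIVE registered line next to the birth skeleton `Lines/trackTransport_birth.lean`
(5 stubs; hardest `stub_markovPassage`). Card: `Lines/tip_kernel.md`; census: `STRATEGY-CENSUS.md`.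

Crux (FIXED; decl `Summit.CriticalPhenomena.SAWScalingLimit.Theses.SAWTrackTransport.AxiomsOfLimit`): every
chordal family `P` that is the ROBUST FULL LIMIT `RL(π/2) P` of the critical (`x = 1`) Glazman–Manolescu
Yang–Baxter walk on the SQUARE tiling, given square-tiling endpoint approximations of every Dobrushin domain,
is (i) translation covariant, (ii) similarity covariant once rotation covariant, (iii) restriction–Markov,
(iv) reversible, (v) conjugation covariant, (vi) carried by simple boundary-avoiding curves.

NB. The crux directory `Cruxes/AxiomsOfLimit/` is SHARED with the homonymous crux of route
SAWRestrictionRigidity (stmt-CriticalPhenomena-1370, uniform `δℤ²` SAW); files of THIS crux carry the prefix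
`trackTransport_` or the slug `tip_kernel`.

## What this line changes (only conjunct (iii); stubs S1–S4 are the birth stubs VERBATIM)

The birth line isolates (iii) in ONE stub `stub_markovPassage : … → P.IsRestriction → SimpleBd P →
P.IsRestrictionMarkov` (XL) whose recorded why-might-fail is "domain-Markov is NOT lattice-exact for the face
walk (a revisited face couples past and future, `w/u² ≈ 0.68`), so (iii) needs irrelevance of revisits or
the compass realisation". The census (`STRATEGY-CENSUS.md` §Transfer) shows that this non-exactness is NOT an
extra obstruction, and this file types the resulting cut:

* LATTICE SIDE, EXACT FOR ANY LAW: the conditional law of the future of the walk given a lattice PREFIX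
  `ω = (z₀, …, zₙ)` is `futureLaw … ω := (ybLaw …)[| prefixEvent ω]` pushed to the future polyline
  (`ProbabilityTheory.cond` on the cylinder of `ω`; no slit domain is ever discretised — `meshFaces` of a slit
  domain deletes every face touching the past, including BOTH faces at the tip, so the walk "of the slit
  domain from the tip" is empty: census (C3)). For Glazman–Manolescu's walk this conditional law is
  explicit: the Yang–Baxter walk on the faces not fully used by `ω`, from the tip `zₙ`, with the one-arc
  weight of every HALF-USED face (one arc of `ω` already drawn in it) changed from `u_κ(π/2)` to
  `w_κ(π/2)/u_κ(π/2)` (`κ ∈ {corner, coCorner}`; a straight past arc blocks its face) — a Yang–Baxter walk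
  with a BOUNDARY DECORATION along the past. RESTRICTION stays exact for it (local weights, empty rhombi
  weigh `1`).
* REVISITS AWAY FROM THE TIP ARE IRRELEVANT WITHOUT ANY ESTIMATE: a future arc in a half-used face lies within
  `2δ` of the past; at distance `≥ r` from the tip this has probability `→ 0` under the law of the WHOLE walk
  by conjunct (vi) for the limit `P D` (portmanteau on the closed event "`γ(s) , γ(s')` are `ε`-close with
  `s ≤ σ ≤ s'` and `γ(s')` `r`-far from `γ(σ)`", then `ε ↓ 0`: a simple curve has no such pair), and the
  decorated weights are DOMINATED termwise by the undecorated ones (`w₁(π/2) = 0.11267… ≤ u₁(π/2)² =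
  0.16678…`, ratio `0.675`), so decorated and undecorated laws of the walk in any sub-domain are
  `2·P[use a decorated face]`-close in total variation (first lemmas L2/L3 of the card).
* REVISITS NEAR THE TIP are part of the MICROSCOPIC TIP ENVIRONMENT, exactly like the ragged lattice boundary
  along the past of the uniform `δℤ²` SAW (sibling child `MarkovOfLimit` of stmt-1370, lead c2's cut S1a
  "tip stability", `Lines/split_markov_c2.lean`): the one load-bearing statement is that the NORMALISED
  conditional future law has a scaling limit depending only on the marked slit domain
  `(remainingDomain D p; p.target, b)` along EVERY lattice past approximation — Kennedy–Lawler's conjecture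
  that lattice effects at an endpoint enter the un-normalised measure only through a multiplicative factor
  (arXiv:1109.3091 §2, "We do not know how to prove this limit exists"), here for the tip of a slit.

So (iii) is cut into THREE stubs over the cylinder-conditioning vocabulary of §2 (MidEdge lists instead of
graph walks, otherwise the vocabulary of `Lines/split_markov_c2.lean`, so that ONE abstract proof of the
Markov passage S6 serves stmt-1370, stmt-16965 and stmt-7299):

* S5 `stub_futureKernelOfRL` (HARDEST, XL): GIVEN the robust chordal limit (the crux's own hypotheses, plus
  restriction and (vi) from S3/S4 — so the stub cannot be falsified by non-existence of limits, unlike a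
  `P`-free version), tip-stable conditional-future scaling limits exist: `∃ Φ, IsFutureKernel Φ`.
* S6 `stub_markovOfKernel` (L–XL, soft but long, MODEL-AGNOSTIC): chordal + `RL` + (vi) + future kernel ⇒
  `P.IsMarkovExtension (kernelOf Φ)` (`initial`: trivial prefix + uniqueness of weak limits; `domain`: free
  for kernels of slit shape, `kernelOf_domain` below; `markov`: the tower identity over the countable partition
  into cylinders — exact for ANY probability law on walks — passed to the limit at the first hitting of
  generic closed sets, then all closed sets by Lévy's upward theorem + tip continuity, which `IsFutureKernel`
  supplies: memo `Lines/split_markov_c2.md` §1(c), §5).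
* S7 `stub_kernelClauseOfKernel` (L–XL): chordal + `RL` + restriction + (vi) + future kernel ⇒
  `P.IsRestrictionKernel (kernelOf Φ)` (lattice-exact restriction of the decorated walk; `0 = 0` off good
  configurations). CONTENT LIVES AT CUSPS (census (C2)): at a proper past the clause is non-trivial only for
  Jordan `D' ⊆ remainingDomain D p` whose boundary leaves the tip tangentially to the slit on both sides
  (opening `2π`; Blumenthal 0–1 + scaling for any limit with SLE-like angular oscillation), where the
  conditioning event `{range ⊆ closure D'}` is never a continuity set and its lattice probability depends on
  the tip geometry of the approximation — the prover must use the freedom to CHOOSE the approximation in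
  `IsFutureKernel`, or argue in the continuum.

`AxiomsOfLimit_of : S1 → S2 → S3 → S4 → S5 → S6 → S7 → SAWTrackTransport.AxiomsOfLimit` is proved below (no
`sorry` of its own) and concludes the crux BY NAME through `axiomsOfLimit_iff := Iff.rfl`; it threads
(vi) → restriction → (future kernel, Markov extension, kernel clause) and DERIVES (ii) from (i) + dilations +
the rotation hypothesis (`isSimilarityCovariant_of_rotation`, copied from the birth file). The birth stub
`stub_markovPassage` FOLLOWS from S5–S7 (`markovPassage_of_tipKernel`, proved): this line refines the birth
line at its hardest stub and changes nothing else. Disproof used: none exists for this crux (no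
`Disproof.lean`, no `Theorems/AxiomsOfLimit/Negative/`); negatives index (11 entries, 2026-08-17) respected —
everything is eventual in `δ` (no `IsTightLaws` over all `δ`, refuted stmt-0772), no locality upgrade
(refuted stmt-0698).

References: A. Glazman, I. Manolescu, *Self-avoiding walk on ℤ² with Yang–Baxter weights*, AIHP 56 (2020),
arXiv:1708.00395, §1 (weights (1), the model on any rhombic tiling; "can traverse the same face twice");
G. Lawler, O. Schramm, W. Werner, *On the scaling limit of planar self-avoiding walk* (2004),
arXiv:math/0204277, §2.3 p. 6 ("the rest of the path is still SAW, in the domain with γ[0,t] removed"),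
§3.4.5 p. 14 (restriction exact; "we expect the total mass C(z,w;D) to be continuous in the triple (D,z,w)";
simplicity heuristic); T. Kennedy, G. Lawler, *Lattice effects in the scaling limit of the two-dimensional
self-avoiding walk* (2013), arXiv:1109.3091, §2; W. Werner, *Lectures on two-dimensional critical
percolation* (2007), §3.2 (2); F. Camia, C. Newman, *Critical percolation exploration path and SLE₆: a proof
of convergence*, PTRF 139 (2007), arXiv:math/0604487, §7, Theorem 4 and Remark 7.1 (spatial Markov property of the
full scaling limit — the solved sibling of S5/S6, driven by RSW six-arm / half-plane three-arm bounds); A. Kemppainen, S. Smirnov, Ann. Probab. 45 (2017),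
Remark 2.8.
-/

noncomputable section

open scoped Topology ENNReal NNReal
open MeasureTheory Filter Set
open Literature.Probability.RandomPlanarGeometry
open Literature.Probability.RandomPlanarGeometry.SAW.YangBaxter
open Literature.Probability.LatticeModels (polyline)

namespace Summit.CriticalPhenomena.SAWScalingLimit.Cruxes.AxiomsOfLimit.TipKernel

/-! ### §1 Vocabulary of the crux (verbatim the birth line's, so that S1–S4 are the SAME registered stubs) -/

/-- **`RL α P` — `P` is the ROBUST FULL LIMIT of the critical Yang–Baxter walk on the rhombic tiling of
constant angle `α`** (verbatim the `let RL` of the route items). [cite: GlazmanManolescu2019, §1] -/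
def RL (α : ℝ) (P : ChordalFamily) : Prop :=
  ∀ (D : DobrushinDomain) (u : ℝ → ℂ) (a b : ℝ → MidEdge), (∀ᶠ δ in 𝓝[>] (0 : ℝ), ‖u δ‖ ≤ δ) →
    (∀ᶠ δ in 𝓝[>] (0 : ℝ), Nonempty (YangBaxterSAW (fun (_ : ℤ) => α)
      ((D.map (similarity 1 one_ne_zero (u δ))).carrier) δ (a δ) (b δ))) →
    Tendsto (fun δ : ℝ => (δ : ℂ) * planeMidpoint (fun (_ : ℤ) => α) (a δ)) (𝓝[>] (0 : ℝ)) (𝓝 (D.pt 0)) →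
    Tendsto (fun δ : ℝ => (δ : ℂ) * planeMidpoint (fun (_ : ℤ) => α) (b δ)) (𝓝[>] (0 : ℝ)) (𝓝 (D.pt 1)) →
    TendstoLaw
      (fun δ (γ : YangBaxterSAW (fun (_ : ℤ) => α) ((D.map (similarity 1 one_ne_zero (u δ))).carrier) δ
        (a δ) (b δ)) => γ.curve (fun (_ : ℤ) => α) δ)
      (fun δ => ybLaw (fun (_ : ℤ) => α) ((D.map (similarity 1 one_ne_zero (u δ))).carrier) δ 1 (a δ) (b δ))
      id (P D)

/-- **Square-tiling endpoint approximations exist** for every Dobrushin domain (the second hypothesis of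
the crux). [folklore] -/
def SqApprox : Prop :=
  ∀ D : DobrushinDomain, ∃ a b : ℝ → MidEdge, IsYBEndpointApprox (fun (_ : ℤ) => Real.pi / 2) D a b

/-- Conjunct (i): translation covariance `P (D + w) = (· + w)_* (P D)`. [cite: Werner2007, §3.2 (1)] -/
def TransCov (P : ChordalFamily) : Prop :=
  ∀ (D : DobrushinDomain) (w : ℂ),
    P (D.map (similarity 1 one_ne_zero w)) = (P D).map (CurveClass.map (similarity 1 one_ne_zero w : C(ℂ, ℂ)))

/-- The hypothesis of conjunct (ii): rotation covariance about the origin. [cite: Werner2007, §3.2 (1)] -/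
def RotCov (P : ChordalFamily) : Prop :=
  ∀ (D : DobrushinDomain) (c : ℂ) (hc : c ≠ 0), ‖c‖ = 1 →
    P (D.map (similarity c hc 0)) = (P D).map (CurveClass.map (similarity c hc 0 : C(ℂ, ℂ)))

/-- Dilation covariance about the origin, `P (r D) = (r ·)_* (P D)`, `r > 0` (exact mesh change
`(rΩ)_δ = r · Ω_{δ/r}`). [folklore] -/
def DilCov (P : ChordalFamily) : Prop :=
  ∀ (D : DobrushinDomain) (r : ℝ) (hr : (r : ℂ) ≠ 0), 0 < r →
    P (D.map (similarity r hr 0)) = (P D).map (CurveClass.map (similarity r hr 0 : C(ℂ, ℂ)))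

/-- Conjunct (v): conjugation covariance (exact mirror of the square tiling in the real axis). [folklore] -/
def ConjCov (P : ChordalFamily) : Prop :=
  ∀ D : DobrushinDomain,
    P (D.map Complex.conjLIE.toHomeomorph) =
      (P D).map (CurveClass.map (Complex.conjLIE.toHomeomorph : C(ℂ, ℂ)))

/-- Conjunct (vi): `P D` is carried by simple curve classes meeting `∂D` only at the two marked points.
[cite: LawlerSchrammWerner2004SAW, §3.4.5] -/
def SimpleBd (P : ChordalFamily) : Prop :=
  ∀ D : DobrushinDomain, ∀ᵐ γ ∂(P D), γ ∈ CurveClass.simple ∧ γ.range ∩ frontier D.carrier ⊆ {D.pt 0, D.pt 1}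

/-- **The crux, de-`let`-ed** (definitionally: `Iff.rfl`). [folklore] -/
theorem axiomsOfLimit_iff :
    Summit.CriticalPhenomena.SAWScalingLimit.Theses.SAWTrackTransport.AxiomsOfLimit ↔
      ∀ P : ChordalFamily, P.IsChordal → SqApprox → RL (Real.pi / 2) P →
        TransCov P ∧ (RotCov P → P.IsSimilarityCovariant) ∧ P.IsRestrictionMarkov ∧ P.IsReversible ∧
          ConjCov P ∧ SimpleBd P :=
  Iff.rfl

/-! ### §2 Conditional futures of the Yang–Baxter walk (cylinder conditioning; no slit discretisation) -/

section Lattice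

variable {Θ : ℤ → ℝ} {Ω : Set ℂ} {δ : ℝ} {a b : MidEdge}

/-- **The cylinder of a lattice prefix `ω = (z₀, …, zₙ)`**: the walks of `Ω_δ` from `a` to `b` whose first
`n + 1` mid-edges are those of `ω` (so `z₀ = a` and `zₙ` is the tip whenever the cylinder is charged). The
conditional law of the walk given this cylinder is Glazman–Manolescu's walk on the faces not fully used by
`ω`, from `zₙ`, with one-arc weight `w_κ/u_κ` on the half-used faces — NOT the walk of a slit domain.
[cite: LawlerSchrammWerner2004SAW, §2.3] -/
def prefixEvent (ω : List MidEdge) : Set (YangBaxterSAW Θ Ω δ a b) :=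
  {γ | ω <+: γ.mids}

/-- **The future of a walk after its first `k` mid-edges**, drawn at mesh `δ` (the polyline through the
rescaled midpoints of `zₖ, zₖ₊₁, …, b`), modulo reparametrisation. [cite: LawlerSchrammWerner2004SAW, §2.3] -/
def futureCurve (Θ : ℤ → ℝ) (δ : ℝ) (k : ℕ) (γ : YangBaxterSAW Θ Ω δ a b) : CurveClass ℂ :=
  CurveClass.mk ⟨polyline ((γ.mids.drop k).map fun e => (δ : ℂ) * planeMidpoint Θ e)⟩

/-- **The conditional law of the future given the lattice prefix `ω`**: the critical (`x = 1`) law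
`ybLaw Θ Ω δ 1 a b` conditioned on the cylinder of `ω` (`ProbabilityTheory.cond`; the zero measure if the
cylinder is not charged), pushed forward to the polyline from the tip `z_{|ω|-1}` on.
[cite: LawlerSchrammWerner2004SAW, §2.3] -/
def futureLaw (Θ : ℤ → ℝ) (Ω : Set ℂ) (δ : ℝ) (a b : MidEdge) (ω : List MidEdge) :
    Measure (CurveClass ℂ) :=
  (ProbabilityTheory.cond (ybLaw Θ Ω δ 1 a b) (prefixEvent ω)).map (futureCurve Θ δ (ω.length - 1))

/-- The lattice prefix drawn at mesh `δ`, modulo reparametrisation. [folklore] -/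
def pastCurve (Θ : ℤ → ℝ) (δ : ℝ) (ω : List MidEdge) : CurveClass ℂ :=
  CurveClass.mk ⟨polyline (ω.map fun e => (δ : ℂ) * planeMidpoint Θ e)⟩

end Lattice

/-- **Lattice approximation of a continuum past** on the square tiling: along `δ → 0⁺` the prefixes `ω δ`
are eventually CHARGED by the critical law from `a_δ` to `b_δ` (some walk extends them; in particular they
are genuine walk prefixes from `a_δ`) and their polylines converge to `p` in `CurveClass ℂ`. [folklore] -/
structure IsPastApprox (D : DobrushinDomain) (a b : ℝ → MidEdge) (p : CurveClass ℂ)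
    (ω : ℝ → List MidEdge) : Prop where
  /-- eventually the cylinder of the prefix has positive critical mass -/
  charged : ∀ᶠ δ in 𝓝[>] (0 : ℝ),
    ybLaw (fun (_ : ℤ) => Real.pi / 2) D.carrier δ 1 (a δ) (b δ) (prefixEvent (ω δ)) ≠ 0
  /-- the polylines of the prefixes converge to `p` -/
  tendsto : Tendsto (fun δ => pastCurve (fun (_ : ℤ) => Real.pi / 2) δ (ω δ)) (𝓝[>] (0 : ℝ)) (𝓝 p)

/-- **Admissible pasts** of `(D; a, b)`: the trivial past (constant curve at `a`) or a simple arc from `a`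
in `D̄` meeting `∂D` at most in `{a, b}`, and meeting `b` only if it ENDS there — exactly the pasts
`stopAt F γ` of a simple chord `γ` from `a` to `b` touching `∂D` only at its endpoints (so `D ∖ p` is
connected and `remainingDomain D p = D ∖ p`: no pockets, no disconnected slit configurations; this sharpens
the sibling vocabulary of `Lines/split_markov_c2.lean`, which allowed a past to run through `b`). [folklore] -/
def admissiblePast (D : DobrushinDomain) : Set (CurveClass ℂ) :=
  {p | p.source = D.pt 0 ∧ p.range ⊆ closure D.carrier ∧ p.range ∩ frontier D.carrier ⊆ {D.pt 0, D.pt 1} ∧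
    (D.pt 1 ∈ p.range → p.target = D.pt 1) ∧
    (p ∈ CurveClass.simple ∨ p = CurveClass.mk (Curve.const (D.pt 0)))}

/-- **Good marked slit configurations** `(R; t, b)`: those of the form `(remainingDomain D p; p.target, D.pt 1)`
for an admissible past `p` of `D` that has a lattice past approximation along some square-tiling endpoint
approximation of `D`. [folklore] -/
def GoodConfig (R : Set ℂ) (t b : ℂ) : Prop :=
  ∃ (D : DobrushinDomain) (a' b' : ℝ → MidEdge) (p : CurveClass ℂ) (ω : ℝ → List MidEdge),
    IsYBEndpointApprox (fun (_ : ℤ) => Real.pi / 2) D a' b' ∧ p ∈ admissiblePast D ∧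
      IsPastApprox D a' b' p ω ∧ remainingDomain D p = R ∧ p.target = t ∧ D.pt 1 = b

/-- The kernel of slit shape attached to `Φ (R; t, b)`: `Q D p := Φ (remainingDomain D p) p.target (D.pt 1)`.
[folklore] -/
def kernelOf (Φ : Set ℂ → ℂ → ℂ → Measure (CurveClass ℂ)) :
    DobrushinDomain → CurveClass ℂ → Measure (CurveClass ℂ) :=
  fun D p => Φ (remainingDomain D p) p.target (D.pt 1)

/-- **Future kernel of the critical square-tiling Yang–Baxter walk** (`Φ (R; t, b)` = law of the future in
the marked slit domain): (i) TIP STABILITY — along every square-tiling endpoint approximation of every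
Dobrushin domain, every admissible past `p` and EVERY lattice past approximation `ω δ → p`, the conditional
future laws `futureLaw … (ω δ)` converge weakly to `Φ (remainingDomain D p; p.target, b)`; (ii) `Φ = 0` off
the good configurations (so that the restriction-kernel clause reads `0 = 0` there).
[cite: LawlerSchrammWerner2004SAW, §2.3] -/
def IsFutureKernel (Φ : Set ℂ → ℂ → ℂ → Measure (CurveClass ℂ)) : Prop :=
  (∀ (D : DobrushinDomain) (a b : ℝ → MidEdge), IsYBEndpointApprox (fun (_ : ℤ) => Real.pi / 2) D a b →
      ∀ p ∈ admissiblePast D, ∀ ω : ℝ → List MidEdge, IsPastApprox D a b p ω →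
        TendstoLaw (fun (_ : ℝ) (η : CurveClass ℂ) => η)
          (fun δ => futureLaw (fun (_ : ℤ) => Real.pi / 2) D.carrier δ (a δ) (b δ) (ω δ)) id
          (kernelOf Φ D p)) ∧
    ∀ (R : Set ℂ) (t b : ℂ), ¬ GoodConfig R t b → Φ R t b = 0

/-- Kernels of slit shape satisfy the `domain` clause of `IsMarkovExtension` for free (c1's shape reduction,
`Lines/split_markovShape.lean`, in one line). [folklore] -/
theorem kernelOf_domain (Φ : Set ℂ → ℂ → ℂ → Measure (CurveClass ℂ)) (D₁ D₂ : DobrushinDomain)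
    (p₁ p₂ : CurveClass ℂ) (hR : remainingDomain D₁ p₁ = remainingDomain D₂ p₂)
    (ht : p₁.target = p₂.target) (hb : D₁.pt 1 = D₂.pt 1) : kernelOf Φ D₁ p₁ = kernelOf Φ D₂ p₂ := by
  simp only [kernelOf, hR, ht, hb]

/-! ### §3 The stubs (the ONLY `sorry`s of this file) -/

/-- **S1 `stub_translationPassage` — (i) translations pass to the robust limit** (size L; = birth S1 verbatim:
`w = δ k_δ + r_δ`, lattice translation exact, remainder absorbed by robustness (`u := r`), Slutsky for the
1-Lipschitz translation action on `CurveClass ℂ`, `TendstoLaw.unique`). [folklore] -/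
theorem stub_translationPassage :
    ∀ P : ChordalFamily, P.IsChordal → SqApprox → RL (Real.pi / 2) P → TransCov P := by
  sorry

/-- **S2 `stub_exactSymmetryPassage` — dilations, reversal and conjugation pass to the robust limit**
(size L; = birth S2 verbatim: three EXACT identities of finite-volume laws at `Θ ≡ π/2`, `x = 1` — mesh change
`meshFaces Θ (rΩ) δ = meshFaces Θ Ω (δ/r)`, weight-preserving reversal `γ ↦ γ^R`, conjugation
face `(k,j) ↦ (k,−j)` with `corner ↔ coCorner` harmless since `u₁(π/2) = u₂(π/2)`, `w₁(π/2) = w₂(π/2)` — plus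
uniqueness of limits in law). [cite: LawlerSchrammWerner2004SAW, §3.1] -/
theorem stub_exactSymmetryPassage :
    ∀ P : ChordalFamily, P.IsChordal → SqApprox → RL (Real.pi / 2) P →
      DilCov P ∧ P.IsReversible ∧ ConjCov P := by
  sorry

/-- **S3 `stub_simplePassage` — (vi) the robust limit is carried by simple curves meeting `∂D` only at the
marked points** (size L–XL; = birth S3 verbatim; the sibling estimate package is
`Cruxes/SimpleOfLimit/Lines/birth.lean`: far-return decay, boundary decay, past/future avoidance).
[cite: LawlerSchrammWerner2004SAW, §3.4.5] -/
theorem stub_simplePassage :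
    ∀ P : ChordalFamily, P.IsChordal → SqApprox → RL (Real.pi / 2) P → SimpleBd P := by
  sorry

/-- **S4 `stub_restrictionPassage` — restriction passes to the robust limit, given (vi)** (size L; = birth S4
verbatim; lattice level EXACT for Glazman–Manolescu's walk: local weights, empty rhombi weigh `1`).
[cite: LawlerSchrammWerner2003Restriction, §1 p. 4] -/
theorem stub_restrictionPassage :
    ∀ P : ChordalFamily, P.IsChordal → SqApprox → RL (Real.pi / 2) P → SimpleBd P → P.IsRestriction := by
  sorry

/-- **S5 `stub_futureKernelOfRL` (HARDEST, XL) — tip-stable conditional futures, GIVEN the robust chordal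
limit, restriction and (vi).** The conditional future laws of the critical square-tiling Yang–Baxter walk
(the decorated walk from the tip: half-used faces carry `w_κ/u_κ`) converge, along every lattice
approximation of every admissible past, to a kernel of slit shape. Inputs foreseen: revisits away from the
tip are TV-irrelevant by (vi) + weight domination `w₁(π/2) ≤ u₁(π/2)²` (no estimate); the limit is then
DETERMINED by `RL` + exact restriction on the cusped Jordan sub-domains of the slit domain, provided those
exhaust the future (`P`-positivity / "no loss of avoidance mass", the slit twin of stmt-0773's third stub)
— what remains is insensitivity to the microscopic tip environment (Kennedy–Lawler).
[cite: KennedyLawler2013, §2] -/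
theorem stub_futureKernelOfRL :
    ∀ P : ChordalFamily, P.IsChordal → SqApprox → RL (Real.pi / 2) P → P.IsRestriction → SimpleBd P →
      ∃ Φ : Set ℂ → ℂ → ℂ → Measure (CurveClass ℂ), IsFutureKernel Φ := by
  sorry

/-- **S6 `stub_markovOfKernel` (L–XL, soft but long, model-agnostic) — Markov passage.** For a chordal robust
limit carried by simple boundary-avoiding curves, every future kernel is a domain-Markov extension
(`initial`: trivial prefix `[a_δ]`, cylinder = everything, + uniqueness of weak limits; `domain`:
`kernelOf_domain`; `markov`: tower identity over the cylinder partition at the first entrance into generic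
thickenings of each closed `F`, joint passage by the generalized continuous-mapping theorem — tip stability
gives continuous convergence —, all closed `F` by Lévy's upward theorem; memo `Lines/split_markov_c2.md`
§1(c), §5). [cite: Werner2007, §3.2 (2)] -/
theorem stub_markovOfKernel :
    ∀ P : ChordalFamily, P.IsChordal → SqApprox → RL (Real.pi / 2) P → SimpleBd P →
      ∀ Φ : Set ℂ → ℂ → ℂ → Measure (CurveClass ℂ), IsFutureKernel Φ → P.IsMarkovExtension (kernelOf Φ) := by
  sorry

/-- **S7 `stub_kernelClauseOfKernel` (L–XL) — the restriction-kernel clause for a future kernel.** Lattice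
level EXACT (the decorated future conditioned to draw its arcs in the faces of `D'_δ` is the decorated walk
of `D'_δ ∩` slit faces; decorations inside `D'_δ` away from the tip are TV-irrelevant as in S5); passage =
the slit twin of `stub_restrictionPassage`, `0 = 0` off good configurations (`IsFutureKernel` (ii)). All
content sits at CUSPED `D'` (census (C2)): the conditioning event is not a continuity set there and its
lattice probability depends on the tip geometry of the approximation — use the freedom to choose `ω δ`.
[cite: LawlerSchrammWerner2003Restriction, §1 p. 4] -/
theorem stub_kernelClauseOfKernel :
    ∀ P : ChordalFamily, P.IsChordal → SqApprox → RL (Real.pi / 2) P → P.IsRestriction → SimpleBd P →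
      ∀ Φ : Set ℂ → ℂ → ℂ → Measure (CurveClass ℂ), IsFutureKernel Φ →
        P.IsRestrictionKernel (kernelOf Φ) := by
  sorry

/-! ### §4 Proved glue -/

/-- `c z + w = 1 · (c z + 0) + w`. [folklore] -/
theorem similarity_eq_rotation_trans_translation (c : ℂ) (hc : c ≠ 0) (w : ℂ) :
    similarity c hc w = (similarity c hc 0).trans (similarity 1 one_ne_zero w) :=
  Homeomorph.ext fun z => by
    rw [Homeomorph.trans_apply, similarity_apply, similarity_apply, similarity_apply]
    ring

/-- **(ii) from (i) + dilations + rotations** (no `sorry`; the birth file's lemma). [folklore] -/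
theorem isSimilarityCovariant_of_rotation {P : ChordalFamily} (hrot : RotCov P) (htr : TransCov P)
    (hdil : DilCov P) : P.IsSimilarityCovariant := by
  have hiso : ∀ (D : DobrushinDomain) (c : ℂ) (hc : c ≠ 0) (w : ℂ), ‖c‖ = 1 →
      P (D.map (similarity c hc w)) = (P D).map (CurveClass.map (similarity c hc w : C(ℂ, ℂ))) := by
    intro D c hc w h1
    rw [similarity_eq_rotation_trans_translation c hc w]
    exact ChordalFamily.covariant_trans (measurable_curveClassMap_similarity c hc 0)
      (measurable_curveClassMap_similarity 1 one_ne_zero w) (fun D => hrot D c hc h1) (fun D => htr D w) D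
  intro D c hc w
  have hr0 : (0 : ℝ) < ‖c‖ := norm_pos_iff.2 hc
  have hr : ((‖c‖ : ℝ) : ℂ) ≠ 0 := Complex.ofReal_ne_zero.2 hr0.ne'
  have hu : c / (‖c‖ : ℂ) ≠ 0 := div_ne_zero hc hr
  have hu1 : ‖c / (‖c‖ : ℂ)‖ = 1 := by
    rw [norm_div, Complex.norm_real, Real.norm_of_nonneg hr0.le, div_self hr0.ne']
  rw [similarity_eq_dilation_trans c hc w hr hu]
  exact ChordalFamily.covariant_trans (measurable_curveClassMap_similarity _ hr 0)
    (measurable_curveClassMap_similarity _ hu w) (fun D => hdil D ‖c‖ hr hr0)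
    (fun D => hiso D _ hu w hu1) D

/-! ### §5 Name-keyed aliases of the seven stub statements (skeleton-check convention) -/
namespace __Registered

/-- Alias keyed by the registered stub name. -/
abbrev stub_translationPassage : Prop :=
  ∀ P : ChordalFamily, P.IsChordal → SqApprox → RL (Real.pi / 2) P → TransCov P
/-- Alias keyed by the registered stub name. -/
abbrev stub_exactSymmetryPassage : Prop :=
  ∀ P : ChordalFamily, P.IsChordal → SqApprox → RL (Real.pi / 2) P → DilCov P ∧ P.IsReversible ∧ ConjCov P
/-- Alias keyed by the registered stub name. -/
abbrev stub_simplePassage : Prop :=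
  ∀ P : ChordalFamily, P.IsChordal → SqApprox → RL (Real.pi / 2) P → SimpleBd P
/-- Alias keyed by the registered stub name. -/
abbrev stub_restrictionPassage : Prop :=
  ∀ P : ChordalFamily, P.IsChordal → SqApprox → RL (Real.pi / 2) P → SimpleBd P → P.IsRestriction
/-- Alias keyed by the registered stub name. -/
abbrev stub_futureKernelOfRL : Prop :=
  ∀ P : ChordalFamily, P.IsChordal → SqApprox → RL (Real.pi / 2) P → P.IsRestriction → SimpleBd P →
    ∃ Φ : Set ℂ → ℂ → ℂ → Measure (CurveClass ℂ), IsFutureKernel Φ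
/-- Alias keyed by the registered stub name. -/
abbrev stub_markovOfKernel : Prop :=
  ∀ P : ChordalFamily, P.IsChordal → SqApprox → RL (Real.pi / 2) P → SimpleBd P →
    ∀ Φ : Set ℂ → ℂ → ℂ → Measure (CurveClass ℂ), IsFutureKernel Φ → P.IsMarkovExtension (kernelOf Φ)
/-- Alias keyed by the registered stub name. -/
abbrev stub_kernelClauseOfKernel : Prop :=
  ∀ P : ChordalFamily, P.IsChordal → SqApprox → RL (Real.pi / 2) P → P.IsRestriction → SimpleBd P →
    ∀ Φ : Set ℂ → ℂ → ℂ → Measure (CurveClass ℂ), IsFutureKernel Φ → P.IsRestrictionKernel (kernelOf Φ)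

end __Registered

/-! ### §6 The skeleton theorem: the seven stubs imply the crux, BY NAME -/

/-- **This line refines the birth line at its hardest stub**: S5–S7 imply the birth stub
`stub_markovPassage` (`… → P.IsRestriction → SimpleBd P → P.IsRestrictionMarkov`), verbatim. [folklore] -/
theorem markovPassage_of_tipKernel (h₅ : __Registered.stub_futureKernelOfRL)
    (h₆ : __Registered.stub_markovOfKernel) (h₇ : __Registered.stub_kernelClauseOfKernel) :
    ∀ P : ChordalFamily, P.IsChordal → SqApprox → RL (Real.pi / 2) P → P.IsRestriction → SimpleBd P →
      P.IsRestrictionMarkov := by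
  intro P hch happ hRL hr hs
  obtain ⟨Φ, hΦ⟩ := h₅ P hch happ hRL hr hs
  exact ChordalFamily.IsRestrictionMarkov.intro (h₆ P hch happ hRL hs Φ hΦ) (h₇ P hch happ hRL hr hs Φ hΦ)

/-- **`SAWTrackTransport.AxiomsOfLimit` from the line** (kernel-checked, no `sorry` of its own): run S1
(translations), unbundle S2 (dilations, reversal, conjugation), run S3 (simplicity), feed it to S4
(restriction), take the tip-stable future kernel of S5, make it a Markov extension (S6) and a restriction
kernel (S7), DERIVE (ii) from S1 + dilations + the rotation hypothesis, and reassemble through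
`axiomsOfLimit_iff`. Hypotheses = the seven stubs under their registered names; conclusion = the route decl,
by name. [folklore] -/
theorem AxiomsOfLimit_of (h₁ : __Registered.stub_translationPassage)
    (h₂ : __Registered.stub_exactSymmetryPassage) (h₃ : __Registered.stub_simplePassage)
    (h₄ : __Registered.stub_restrictionPassage) (h₅ : __Registered.stub_futureKernelOfRL)
    (h₆ : __Registered.stub_markovOfKernel) (h₇ : __Registered.stub_kernelClauseOfKernel) :
    Summit.CriticalPhenomena.SAWScalingLimit.Theses.SAWTrackTransport.AxiomsOfLimit :=
  axiomsOfLimit_iff.2 fun P hch happ hRL => by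
    have htr : TransCov P := h₁ P hch happ hRL
    obtain ⟨hdil, hrev, hconj⟩ := h₂ P hch happ hRL
    have hs : SimpleBd P := h₃ P hch happ hRL
    have hr : P.IsRestriction := h₄ P hch happ hRL hs
    have hm : P.IsRestrictionMarkov := markovPassage_of_tipKernel h₅ h₆ h₇ P hch happ hRL hr hs
    exact ⟨htr, fun hrot => isSimilarityCovariant_of_rotation hrot htr hdil, hm, hrev, hconj, hs⟩

/-- Wiring check (an `example`, so that `AxiomsOfLimit_of` stays the only theorem concluding the crux). -/
example : Summit.CriticalPhenomena.SAWScalingLimit.Theses.SAWTrackTransport.AxiomsOfLimit :=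
  AxiomsOfLimit_of stub_translationPassage stub_exactSymmetryPassage stub_simplePassage
    stub_restrictionPassage stub_futureKernelOfRL stub_markovOfKernel stub_kernelClauseOfKernel

end Summit.CriticalPhenomena.SAWScalingLimit.Cruxes.AxiomsOfLimit.TipKernel

end
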